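import Mathlib
import HarnessLib

/-!
# Test-function uniqueness: isometry invariance of a kernel from invariance of its integrals,
# and linear isometries of `ℝ³` as orthogonal matrices
(crux `IsingEuclidUpgradeR2RotInvPowerLaw`, item stmt-CriticalPhenomena-0634, line `tower_profile_rigidity`,
variant V; helper file, pure analysis / linear algebra, no model content)

* `kernel_isometry_invariant_of_integrals` — a du Bois-Reymond-type lemma: if `K` is continuous off the
  origin of `ℝ³`, `T` is a linear isometry, and `∫ φ(T y) K(y) dy = ∫ φ(y) K(y) dy` for every continuous,
  compactly supported `φ ≥ 0`, `φ ≢ 0`, vanishing near `0`, then `K ∘ T = K` off the origin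
  (change of variables by the measure-preserving `T`, then localisation with a bump test function).
* `exists_orthogonal_of_linearIsometryEquiv` — every linear isometry `T` of `EuclideanSpace ℝ (Fin 3)` acts
  on coordinates by an orthogonal matrix (the matrix of `T` in the standard orthonormal basis).

References: G. B. Folland, *Real Analysis* (1999), Thm. 2.44 (linear change of variables) and the
fundamental lemma of the calculus of variations (du Bois-Reymond); both statements are folklore.
No definitions are introduced.
-/

noncomputable section

open MeasureTheory Metric Set Filter Topology

namespace Summit.CriticalPhenomena.Ising3DConformalLimit.Cruxes.IsingEuclidUpgradeR2RotInvPowerLaw.TowerProfileRigidity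

/-! ### Linear isometries of `ℝ³` are orthogonal matrices -/

/-- Every linear isometry `T` of `EuclideanSpace ℝ (Fin 3)` acts on coordinates by an orthogonal `3 × 3`
matrix `R`, namely the matrix of `T` in the standard orthonormal basis (`R i j = (T eⱼ)ᵢ`); its columns
`T eⱼ` are orthonormal, so `Rᵀ R = 1`. [folklore] -/
theorem exists_orthogonal_of_linearIsometryEquiv : ∀ T : EuclideanSpace ℝ (Fin 3) ≃ₗᵢ[ℝ] EuclideanSpace ℝ (Fin 3), ∃ R : Matrix.orthogonalGroup (Fin 3) ℝ, ∀ y : EuclideanSpace ℝ (Fin 3), (T y).ofLp = R.1.mulVec y.ofLp := by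
  intro T
  refine ⟨⟨(EuclideanSpace.basisFun (Fin 3) ℝ).toBasis.toMatrix
      ((EuclideanSpace.basisFun (Fin 3) ℝ).map T),
    (EuclideanSpace.basisFun (Fin 3) ℝ).toMatrix_orthonormalBasis_mem_orthogonal _⟩, fun y => ?_⟩
  -- entries of the matrix: `R i j = (T eⱼ) i`
  have hR : ∀ i j, (EuclideanSpace.basisFun (Fin 3) ℝ).toBasis.toMatrix
      ((EuclideanSpace.basisFun (Fin 3) ℝ).map T) i j = T (EuclideanSpace.basisFun (Fin 3) ℝ j) i := by
    intro i j
    rw [Module.Basis.toMatrix_apply, OrthonormalBasis.coe_toBasis_repr_apply,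
      OrthonormalBasis.map_apply, EuclideanSpace.basisFun_repr]
  -- expand `y` in the standard basis and use linearity of `T`
  have hy : T y = ∑ j, y j • T (EuclideanSpace.basisFun (Fin 3) ℝ j) := by
    conv_lhs => rw [← (EuclideanSpace.basisFun (Fin 3) ℝ).sum_repr y]
    rw [map_sum]
    refine Finset.sum_congr rfl fun j _ => ?_
    rw [LinearIsometryEquiv.map_smul, EuclideanSpace.basisFun_repr]
  funext i
  dsimp only
  rw [Matrix.mulVec_apply_eq_sum, hy, WithLp.ofLp_sum, Finset.sum_apply]
  refine Finset.sum_congr rfl fun j _ => ?_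
  rw [hR, WithLp.ofLp_smul, Pi.smul_apply, smul_eq_mul, mul_comm]

/-! ### A du Bois-Reymond lemma off the origin -/

/-- A continuous `φ` vanishing on a ball around `0`, multiplied by a function `g` continuous off the
origin, is continuous on all of `ℝ³`. [folklore] -/
private theorem continuous_mul_of_eq_zero_near_zero {φ g : EuclideanSpace ℝ (Fin 3) → ℝ}
    (hφ : Continuous φ) {ε : ℝ} (hε : 0 < ε) (hφε : ∀ y, ‖y‖ < ε → φ y = 0)
    (hg : ContinuousOn g {0}ᶜ) : Continuous fun y => φ y * g y := by
  refine continuous_iff_continuousAt.2 fun y => ?_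
  by_cases hy : y = 0
  · subst hy
    have h0 : (fun _ => (0 : ℝ)) =ᶠ[𝓝 (0 : EuclideanSpace ℝ (Fin 3))]
        fun y => φ y * g y := by
      refine Metric.eventually_nhds_iff.2 ⟨ε, hε, fun w hw => ?_⟩
      rw [dist_zero_right] at hw
      simp [hφε w hw]
    exact continuousAt_const.congr h0
  · exact hφ.continuousAt.mul (hg.continuousAt (isOpen_compl_singleton.mem_nhds hy))

/-- A continuous bump on `ℝ³`: nonnegative, compactly supported, positive at `z`, supported in
`ball z r` (the tent `w ↦ max (r - dist w z) 0`). [folklore] -/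
private theorem exists_bump (z : EuclideanSpace ℝ (Fin 3)) {r : ℝ} (hr : 0 < r) :
    ∃ φ : EuclideanSpace ℝ (Fin 3) → ℝ, Continuous φ ∧ HasCompactSupport φ ∧
      (∀ w, 0 ≤ φ w) ∧ 0 < φ z ∧ ∀ w, φ w ≠ 0 → dist w z < r := by
  refine ⟨fun w => max (r - dist w z) 0, ?_, ?_, fun w => le_max_right _ _, ?_, ?_⟩
  · exact (continuous_const.sub (continuous_id.dist continuous_const)).max continuous_const
  · refine HasCompactSupport.intro (isCompact_closedBall z r) fun w hw => ?_
    rw [mem_closedBall, not_le] at hw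
    exact max_eq_right (by linarith)
  · show 0 < max (r - dist z z) 0
    rw [dist_self, sub_zero]
    exact lt_max_iff.2 (Or.inl hr)
  · intro w hw
    by_contra h
    exact hw (max_eq_right (by linarith [not_lt.1 h]))

/-- **du Bois-Reymond lemma off the origin.** If `K₁, K₂` are continuous on `ℝ³ ∖ {0}` and
`∫ φ K₁ = ∫ φ K₂` for every continuous compactly supported `φ ≥ 0`, `φ ≢ 0`, vanishing near `0`, then
`K₁ = K₂` off the origin: otherwise localise with a bump around a point where `(K₁ - K₂)² > 0`.
[folklore]; cf. G. B. Folland, *Real Analysis* (1999), Ch. 2 and the fundamental lemma of the calculus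
of variations. -/
private theorem eq_of_forall_integral_mul_eq {K₁ K₂ : EuclideanSpace ℝ (Fin 3) → ℝ}
    (h₁ : ContinuousOn K₁ {0}ᶜ) (h₂ : ContinuousOn K₂ {0}ᶜ)
    (hint : ∀ φ : EuclideanSpace ℝ (Fin 3) → ℝ, Continuous φ → HasCompactSupport φ →
      (∀ y, 0 ≤ φ y) → (∃ y, 0 < φ y) → (∃ ε : ℝ, 0 < ε ∧ ∀ y, ‖y‖ < ε → φ y = 0) →
      ∫ y, φ y * K₁ y = ∫ y, φ y * K₂ y)
    {z : EuclideanSpace ℝ (Fin 3)} (hz : z ≠ 0) : K₁ z = K₂ z := by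
  by_contra hne
  have hz' : z ∈ ({0}ᶜ : Set (EuclideanSpace ℝ (Fin 3))) := Set.mem_compl_singleton_iff.2 hz
  -- the localising weight `(K₁ z - K₂ z) * (K₁ - K₂)` is continuous off `0` and positive near `z`
  have hDcont : ContinuousOn (fun w => (K₁ z - K₂ z) * (K₁ w - K₂ w)) {0}ᶜ :=
    continuousOn_const.mul (h₁.sub h₂)
  have hDz : 0 < (K₁ z - K₂ z) * (K₁ z - K₂ z) := mul_self_pos.2 (sub_ne_zero.2 hne)
  obtain ⟨r₁, hr₁, hball⟩ := Metric.eventually_nhds_iff_ball.1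
    ((hDcont.continuousAt (isOpen_compl_singleton.mem_nhds hz')).eventually
      (eventually_gt_nhds hDz))
  have hz2 : 0 < ‖z‖ / 2 := half_pos (norm_pos_iff.2 hz)
  -- a bump supported in `ball z (min r₁ (‖z‖ / 2))`
  obtain ⟨φ, hφc, hφcs, hφnn, hφz, hφsupp⟩ := exists_bump z (lt_min hr₁ hz2)
  have hφball : ∀ w, φ w ≠ 0 → w ∈ ball z r₁ := fun w hw =>
    mem_ball.2 ((hφsupp w hw).trans_le (min_le_left _ _))
  have hφzero : ∀ w, ‖w‖ < ‖z‖ / 2 → φ w = 0 := by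
    intro w hw
    by_contra hne'
    have hd : dist w z < ‖z‖ / 2 := (hφsupp w hne').trans_le (min_le_right _ _)
    have hd' : ‖z‖ - ‖w‖ ≤ dist w z := by
      rw [dist_comm, dist_eq_norm]
      exact norm_sub_norm_le z w
    linarith
  -- the hypothesis for this `φ`, and integrability of both sides
  have hI := hint φ hφc hφcs hφnn ⟨z, hφz⟩ ⟨‖z‖ / 2, hz2, hφzero⟩
  have hi₁ : Integrable (fun w => φ w * K₁ w) :=
    (continuous_mul_of_eq_zero_near_zero hφc hz2 hφzero h₁).integrable_of_hasCompactSupport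
      (hφcs.mul_right (f' := K₁))
  have hi₂ : Integrable (fun w => φ w * K₂ w) :=
    (continuous_mul_of_eq_zero_near_zero hφc hz2 hφzero h₂).integrable_of_hasCompactSupport
      (hφcs.mul_right (f' := K₂))
  -- `∫ φ · (K₁ z - K₂ z)(K₁ - K₂) = (K₁ z - K₂ z) (∫ φ K₁ - ∫ φ K₂) = 0`
  have hzero : ∫ w, φ w * ((K₁ z - K₂ z) * (K₁ w - K₂ w)) = 0 := by
    have hfun : (fun w => φ w * ((K₁ z - K₂ z) * (K₁ w - K₂ w))) =
        fun w => (K₁ z - K₂ z) * (φ w * K₁ w) - (K₁ z - K₂ z) * (φ w * K₂ w) := by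
      funext w
      ring
    rw [hfun, integral_sub (hi₁.const_mul _) (hi₂.const_mul _), integral_const_mul,
      integral_const_mul, hI, sub_self]
  -- `… > 0`: the integrand is continuous, compactly supported, nonnegative and positive at `z`
  have hpos : 0 < ∫ w, φ w * ((K₁ z - K₂ z) * (K₁ w - K₂ w)) := by
    refine Continuous.integral_pos_of_hasCompactSupport_nonneg_nonzero (x := z)
      (continuous_mul_of_eq_zero_near_zero hφc hz2 hφzero hDcont)
      (hφcs.mul_right (f' := fun w => (K₁ z - K₂ z) * (K₁ w - K₂ w))) (fun w => ?_)
      (mul_pos hφz hDz).ne'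
    show 0 ≤ φ w * ((K₁ z - K₂ z) * (K₁ w - K₂ w))
    by_cases hw : φ w = 0
    · simp [hw]
    · exact mul_nonneg (hφnn w) (hball w (hφball w hw)).le
  exact hpos.ne' hzero

/-- Change of variables by a linear isometry `T` of `ℝ³`, which preserves Lebesgue measure:
`∫ φ(T y) K(y) dy = ∫ φ(y) K(T⁻¹ y) dy`. [folklore]; cf. G. B. Folland, *Real Analysis* (1999),
Thm. 2.44. -/
private theorem integral_comp_isometry_mul
    (T : EuclideanSpace ℝ (Fin 3) ≃ₗᵢ[ℝ] EuclideanSpace ℝ (Fin 3))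
    (φ K : EuclideanSpace ℝ (Fin 3) → ℝ) :
    ∫ y, φ (T y) * K y = ∫ y, φ y * K (T.symm y) := by
  have h := T.measurePreserving.integral_comp T.toHomeomorph.measurableEmbedding
    (fun y => φ y * K (T.symm y))
  simp only [LinearIsometryEquiv.symm_apply_apply] at h
  exact h

/-- **Isometry invariance of a kernel from invariance of its integrals** (test-function uniqueness).
If `K : ℝ³ → ℝ` is continuous off the origin, `T` is a linear isometry of `ℝ³`, and
`∫ φ(T y) K(y) dy = ∫ φ(y) K(y) dy` for every continuous compactly supported test function `φ ≥ 0`,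
`φ ≢ 0`, vanishing near `0`, then `K (T y) = K y` for all `y ≠ 0`. Proof: `T` preserves Lebesgue
measure, so the hypothesis reads `∫ φ · (K ∘ T⁻¹) = ∫ φ · K`; the du Bois-Reymond lemma off the origin
gives `K ∘ T⁻¹ = K` there, and one substitutes `y ↦ T y`. [folklore]; cf. G. B. Folland,
*Real Analysis* (1999), Thm. 2.44. -/
theorem kernel_isometry_invariant_of_integrals : ∀ {K : EuclideanSpace ℝ (Fin 3) → ℝ}, ContinuousOn K {0}ᶜ → ∀ (T : EuclideanSpace ℝ (Fin 3) ≃ₗᵢ[ℝ] EuclideanSpace ℝ (Fin 3)), (∀ φ : EuclideanSpace ℝ (Fin 3) → ℝ, Continuous φ → HasCompactSupport φ → (∀ y, 0 ≤ φ y) → (∃ y, 0 < φ y) → (∃ ε : ℝ, 0 < ε ∧ ∀ y, ‖y‖ < ε → φ y = 0) → ∫ y, φ (T y) * K y = ∫ y, φ y * K y) → ∀ y : EuclideanSpace ℝ (Fin 3), y ≠ 0 → K (T y) = K y := by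
  intro K hK T hT y hy
  -- `T⁻¹` maps `ℝ³ ∖ {0}` to itself, so `K ∘ T⁻¹` is continuous there
  have h0 : ∀ w : EuclideanSpace ℝ (Fin 3), w ≠ 0 → T.symm w ≠ 0 := fun w hw h =>
    hw (by rw [← T.apply_symm_apply w, h, LinearIsometryEquiv.map_zero])
  have h₁ : ContinuousOn (fun w => K (T.symm w)) {0}ᶜ :=
    hK.comp T.symm.continuous.continuousOn fun w hw =>
      Set.mem_compl_singleton_iff.2 (h0 w (Set.mem_compl_singleton_iff.1 hw))
  have hTy : T y ≠ 0 := fun h => hy ((LinearIsometryEquiv.map_eq_zero_iff T).1 h)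
  -- du Bois-Reymond at the point `T y`
  have key : K (T.symm (T y)) = K (T y) :=
    eq_of_forall_integral_mul_eq (K₁ := fun w => K (T.symm w)) h₁ hK
      (fun φ hφc hφcs hφnn hφpos hφε =>
        (integral_comp_isometry_mul T φ K).symm.trans (hT φ hφc hφcs hφnn hφpos hφε)) hTy
  rw [LinearIsometryEquiv.symm_apply_apply] at key
  exact key.symm

end Summit.CriticalPhenomena.Ising3DConformalLimit.Cruxes.IsingEuclidUpgradeR2RotInvPowerLaw.TowerProfileRigidity
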